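import Literature.NumberTheory.GelbartRogawski1991.DoubledWeilRepresentationArchLift
import Literature.NumberTheory.GelbartRogawski1991.DoubledWeilRepresentationArchTwist
import Literature.NumberTheory.GelbartRogawski1991.DoubledGramDiagonal
import Literature.NumberTheory.Weil1964.ArchUnitaryWeilHalfQuotient
import HarnessLib

-- buildfix G11b-3 recipe (LEDGER B13-1/B13-3): elaborate sequentially so the trailing `attribute [implicit_reducible]`
-- block (reducibilityCoreExt is keyed to the async environment branch) is in force at `.olean` export.
set_option Elab.async false

/-!
# The doubled Weil representation, archimedean half (III): existence of the archimedean half `IsArchHalf χ s_∞`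
([GelbartRogawski1991, §3.1 Prop. 3.1.1 p. 455]: archimedean places of the kernel construction of the compatible
splitting of the metaplectic cover over `U(V ⊕ −V)(𝔸)`; [Kudla1994, §3]; [Paul1998, §1.2 (1.2.1)–(1.2.2)]: the
`det^{1/2}`-normalised section and its `det`-power twists)

Topic `NumberTheory/GelbartRogawski1991`; namespace `Literature.NumberTheory.GelbartRogawski1991.GRConstruction`.
KERNEL only: proved theorems; no definition, no named fact, no `sorry`.

The generic theorem `isArchHalf_twist_archLift` of part (II) is instantiated at

* the real frame `eW :=` Folland's scaled frame of `𝕎^𝔻_∞` attached to the diagonal Gram matrix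
  `T^𝔻 = diag(t₀^𝔻)`, `t₀^𝔻 = (t₀ ⊕ (−t₀)) ∘ e₂⁻¹`, `t₀ = cmGramEntry` (`DoubledGramDiagonal`, `gramD_eq_diagonal_cm`);
* the section `sW := archWeilSectionS` — Folland's `det^{1/2}`-normalised unitary metaplectic section of
  `∏_v U(p_v, q_v)` read in that frame — and its lift `sa := archWeilHalf = archLift …` (`Weil1964.ArchUnitaryWeilHalf`;
  `hsa := rfl`);
* the twist `η = ∏_v det(g_{w(v)})^{(e_{w(v)}+1)/2}` of `DoubledWeilRepresentationArchTwist.exists_archDetTwist_chiDet`,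
  which matches `χ` on `P_Δ(L⁺ ⊗ ℝ)` because Folland's quotient character of `sW g` is `∏_v det(g_{w(v)})⁻¹`
  (`ArchUnitaryWeilHalfQuotient.quot_archWeilSectionS`).

Result: **`exists_isArchHalf`** — for every unitary Hecke character `χ` of the CM field `L` with
`χ|_{𝕀_{L⁺}} = ε_{L/L⁺}` there is an archimedean half `s_∞ : H(L⁺ ⊗ ℝ) →* Mp(𝕎^𝔻)ᶜᵒⁿᵗ` of the doubled Weil
representation with the parabolic normalisation `χ(det_Δ p) |det_Δ p|^{1/2}` on `P_Δ(L⁺ ⊗ ℝ)`: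
`∃ sa, IsArchHalf L e dV hdV hdV0 dW hdW hdW0 χ sa` — the archimedean input of the kernel construction of the compatible
splitting [GelbartRogawski1991, Prop. 3.1.1] (the finite input is `DoubledWeilRepresentationLocalFamilyCM`).  Written for
the stage-1 cell `pub-hodgecm` (seat GR-3); nothing here is a claim of the manuscripts adjudicated by that cell.

## References

* S. Gelbart, J. Rogawski, *L-functions and Fourier–Jacobi coefficients for the unitary group U(3)*, Invent. Math. 105
  (1991), §3.1 Prop. 3.1.1 p. 455 [GelbartRogawski1991].
* S. S. Kudla, *Splitting metaplectic covers of dual reductive pairs*, Israel J. Math. 87 (1994) 361–401, §3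
  [Kudla1994].
* A. Paul, *Howe correspondence for real unitary groups*, J. Funct. Anal. 159 (1998), §1.2 (1.2.1)–(1.2.2) p. 389
  [Paul1998].
* M. Harris, S. S. Kudla, W. J. Sweet, *Theta dichotomy for unitary groups*, J. Amer. Math. Soc. 9 (1996), §1 (1.9)
  [HarrisKudlaSweet1996].
-/

set_option autoImplicit false

noncomputable section

open scoped Classical
open scoped Matrix Kronecker TensorProduct
open NumberField IsDedekindDomain
open Literature.RepresentationTheory.HeisenbergGroup
open Literature.NumberTheory.Automorphic
open Literature.NumberTheory.Weil1964
open Literature.RepresentationTheory.HarrisKudlaSweet1996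
open Literature.NumberTheory.GaloisRepresentations

namespace Literature.NumberTheory.GelbartRogawski1991.GRConstruction

open UnitaryDualPair

variable (L : Type) [Field L] [NumberField L] [IsCMField L]
variable {N M n : ℕ} (e : Fin N × Fin M ≃ Fin n)
  (dV : Fin N → L) (hdV : ∀ i, IsCMField.complexConj L (dV i) = dV i) (hdV0 : ∀ i, dV i ≠ 0)
  (dW : Fin M → L) (hdW : ∀ i, IsCMField.complexConj L (dW i) = dW i) (hdW0 : ∀ i, dW i ≠ 0)

/-- **`T^𝔻 = diag(t₀^𝔻)`** with `t₀^𝔻 = (cmGramEntry ⊕ (−cmGramEntry)) ∘ e₂⁻¹` (the datum's `gramD` is the tree's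
`LocalSplitting.gramD L⁺ n (gram L⁺ e (realDiagonal dV) (realDiagonal dW))`, definitionally).
[cite: HarrisKudlaSweet1996, §1 (1.9)] -/
theorem gramD_eq_diagonal_cm :
    gramD L e dV hdV dW hdW =
      Matrix.diagonal fun k => Sum.elim (cmGramEntry L e dV hdV dW hdW) (-cmGramEntry L e dV hdV dW hdW)
        ((LocalSplitting.e₂ n).symm k) := by
  unfold gramD gramR
  exact gramD_gram_realDiagonal L e dV hdV dW hdW

include hdV0 hdW0 in
set_option maxHeartbeats 1600000 in
-- (the instantiation unfolds `archWeilHalf = archLift …` and `toSpD`, `gramDA` definitionally)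
/-- **THE ARCHIMEDEAN HALF EXISTS**: for a unitary Hecke character `χ` of the CM field `L` with `χ|_{𝕀_{L⁺}} = ε_{L/L⁺}`
there is `s_∞ : H(L⁺ ⊗ ℝ) →* Mp(𝕎^𝔻)ᶜᵒⁿᵗ` over `ι^𝔻`, continuous, by archimedean operators, with the origin values
`χ(det_Δ p) |det_Δ p|^{1/2}` on `P_Δ(L⁺ ⊗ ℝ)` — namely `s_∞ = archWeilHalf ⊗ η`, Folland's `det^{1/2}`-normalised section
twisted by `η = ∏_v det(g_{w(v)})^{(e_{w(v)}+1)/2}`. [cite: GelbartRogawski1991, §3.1 Prop. 3.1.1 p. 455] -/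
theorem exists_isArchHalf (χ : HeckeCharacter L) (hχu : χ.IsUnitary) (hχ : IsSplittingChar L 1 χ) :
    ∃ sa, IsArchHalf L e dV hdV hdV0 dW hdW hdW0 χ sa := by
  have hc : IsCMField.complexConj L ≠ 1 := IsCMField.complexConj_ne_one L
  have ht0 := gramD_gram_realDiagonal_entry_ne_zero L e dV hdV dW hdW hdV0 hdW0
  have hTd := gramD_eq_diagonal_cm L e dV hdV dW hdW
  obtain ⟨η, hηc, hη⟩ := exists_archDetTwist_chiDet L e dV hdV hdV0 dW hdW hdW0 hc (cmPlaceOver L)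
    (cmPlaceOver_smul L) (cmPlaceOver_comap L) hχu hχ
  exact ⟨_, isArchHalf_twist_archLift L e dV hdV hdV0 dW hdW hdW0
    (UnitaryGroup.archToAdelic (Fp L) L (IsCMField.complexConj L) (n + n) (hermD L e dV hdV dW hdW)) rfl
    (scaledFrame (Fp L) (Fin (n + n))
      (placeScale (n + n) fun v => sqrtAbs (signVec (cmPlaceOver L)
        (fun k => Sum.elim (cmGramEntry L e dV hdV dW hdW) (-cmGramEntry L e dV hdV dW hdW)
          ((LocalSplitting.e₂ n).symm k)) (imagUnit L) v))
      (placeScale_ne_zero (n + n) (sqrtAbs_signVec_ne_zero hc (cmPlaceOver_smul L) (complexConj_imagUnit L)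
        (imagUnit_ne_zero L) ht0)))
    (archWeilSectionS L (IsCMField.complexConj L) (n + n) hc (cmPlaceOver L) (cmPlaceOver_smul L) (cmPlaceOver_comap L)
      _ ht0 hTd (J := hermD L e dV hdV dW hdW) rfl (complexConj_imagUnit L) (imagUnit_ne_zero L))
    (adelicToSymplectic_comp_archToAdelic_finVec L (IsCMField.complexConj L) (n + n) (J := hermD L e dV hdV dW hdW)
      (T := gramD L e dV hdV dW hdW) rfl (complexConj_imagUnit L) (imagUnit_ne_zero L) (imagUnit_mul_self L)
      (gramD_isSymm L e dV hdV dW hdW))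
    (archPhaseMap_eq_coe_proj_archWeilSectionS L (IsCMField.complexConj L) (n + n) hc (cmPlaceOver L)
      (cmPlaceOver_smul L) (cmPlaceOver_comap L) _ ht0 hTd (J := hermD L e dV hdV dW hdW) rfl
      (complexConj_imagUnit L) (imagUnit_ne_zero L) (imagUnit_mul_self L) (gramD_isSymm L e dV hdV dW hdW)
      (isUnit_archMat_gramDA L e dV hdV hdV0 dW hdW hdW0))
    (archWeilHalf L (IsCMField.complexConj L) (n + n) hc (cmPlaceOver L) (cmPlaceOver_smul L) (cmPlaceOver_comap L)
      _ ht0 hTd (J := hermD L e dV hdV dW hdW) rfl (complexConj_imagUnit L) (imagUnit_ne_zero L) (imagUnit_mul_self L)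
      (gramD_isSymm L e dV hdV dW hdW) (isUnit_archMat_gramDA L e dV hdV hdV0 dW hdW hdW0))
    rfl χ
    (continuous_archWeilHalf L (IsCMField.complexConj L) (n + n) hc (cmPlaceOver L) (cmPlaceOver_smul L)
      (cmPlaceOver_comap L) _ ht0 hTd (J := hermD L e dV hdV dW hdW) rfl (complexConj_imagUnit L) (imagUnit_ne_zero L)
      (imagUnit_mul_self L) (gramD_isSymm L e dV hdV dW hdW) (isUnit_archMat_gramDA L e dV hdV hdV0 dW hdW hdW0))
    η hηc (fun g hS => by rw [quot_archWeilSectionS]; exact hη g hS)⟩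

/-! ### Build-lane note (ops-buildfix G11b-3 recipe, LEDGER B13-1, 2026-08-21)
`lean -o` (the hub build lane, never `lean`/the gate check) runs Lean 4.32's library-suggestion indexers
(`Lean.LibrarySuggestions.SymbolFrequency` / `SineQuaNon`, from their `exportEntriesFn`) over the statement of
every local theorem that is not a denied premise; on this family's statements (very large dependent binder
telescopes through the theta-kernel / dual-pair data) that fold runs for tens of minutes to hours and the build
lane kills the job (incident G11b-3, run/shared/lean/ops/buildfix/G11b-3-DOSSIER.md). `isDeniedPremise` skips
`[implicit_reducible]` constants before any fold, and a reducibility status on a *theorem* is inert (Meta never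
unfolds `thmInfo`; the kernel ignores the attribute), so the public theorems of this file are tagged
`[implicit_reducible]` purely to keep them out of that index. Only other effect: they are not offered by
`+suggestions` premise selectors. No statement or proof is changed; superseded if the operator lands a
deny-list form (`HarnessLib.PremiseIndex`). -/
set_option allowUnsafeReducibility true in
attribute [implicit_reducible]
  gramD_eq_diagonal_cm exists_isArchHalf

end Literature.NumberTheory.GelbartRogawski1991.GRConstruction

end
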